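import Mathlib.Algebra.Polynomial.SpecificDegree
import Mathlib.FieldTheory.Galois.Abelian
import Mathlib.RingTheory.Norm.Basic
import Literature.NumberTheory.Automorphic.AdicCompletionLocalField
import Literature.NumberTheory.GaloisRepresentations.LocalExistenceTheorem
import Literature.NumberTheory.QuadraticForms.QuadraticNormIndex
import HarnessLib

/-!
# The quadratic norm group as a norm group of local class field theory: O'Meara 63:13 / 63:13a
# at every place from the fundamental equality `[Fˣ : N_{E/F} Eˣ] = [E : F]`

Topic `NumberTheory/QuadraticForms`; namespace `Literature`; all declarations fully proved.

For a field `F`, a non-square `a ∈ F` and a square root `α` of `a` in an extension `Ω`, the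
simple extension `E = F⟮α⟯` is quadratic and the norm of `x + y α` is `x² - a y²`; hence the norm
group `N_{E/F}(Eˣ) ≤ Fˣ` (as used in
`Literature/NumberTheory/GaloisRepresentations/LocalExistenceTheorem.lean`: the range of
`Units.map (Algebra.norm F)`) *is* the group `quadraticNormSubgroup F a` of
`QuadraticNormIndex.lean`:

* `minpoly_of_sq_eq`, `finrank_adjoin_of_sq_eq` : `minpoly F α = X² - a`, `[F⟮α⟯ : F] = 2`;
* `norm_adjoin_of_sq_eq` : `N_{F⟮α⟯/F}(x + y α) = x² - a y²` (determinant of multiplication by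
  `x + y α` in the basis `1, α`);
* `range_norm_adjoin_of_sq_eq` : `N_{F⟮α⟯/F}(F⟮α⟯ˣ) = quadraticNormSubgroup F a`;
* `isAbelianGalois_adjoin_rootSet` : for `2 ≠ 0` in `F`, `F(√a) ⊆ F̄` (the field generated by
  the roots of `X² - a` in the algebraic closure) is a finite abelian Galois extension of degree
  `2`, equal to `F⟮α⟯`.

Consequently, over a non-archimedean local field `F` of characteristic `0` (or just `2 ≠ 0`),
the **fundamental equality of local class field theory** `[Fˣ : N_{E/F}(Eˣ)] = [E : F]` for
abelian `E/F` (the named fact `index_normSubgroup_eq_finrank F` of `LocalExistenceTheorem.lean`,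
Serre, *Local Fields*, XIII §4 Prop. 9) gives

* `index_quadraticNormSubgroup_eq_two_of_index_normSubgroup_eq_finrank` : **O'Meara 63:13a**,
  `(Fˣ : N_{F(√a)/F}) = 2` for every non-square `a`, at *every* place (dyadic ones included);
* `adicCompletion_exists_hilbertSymbol_eq_neg_one_of_index_normSubgroup_eq_finrank` : for a
  number field `K`, the named fact `adicCompletion_exists_hilbertSymbol_eq_neg_one K`
  (**O'Meara 63:13**: a local non-norm, i.e. `α` with `(α, β)_v = -1`, exists for every
  non-square `β ∈ K_v`) follows from `index_normSubgroup_eq_finrank (v.adicCompletion K)` at all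
  finite places `v` — here `K_v` is a non-archimedean local field by the instances of
  `Literature/NumberTheory/Automorphic/AdicCompletionLocalField.lean`.

So the local input of O'Meara's proof of 71:19 (`HilbertSymbolPrescribedProofs.lean`) is a
consequence of the local reciprocity law already in the trust base of the Galois-representation
files; the non-dyadic places are moreover proved outright in `HilbertSymbolLocal.lean`. (The
resulting reduction of O'Meara 71:19, `exists_hilbertSymbol_eq_neg_one_iff K`, to the global norm
index theorem 65:21, the local fundamental equality and Hilbert reciprocity is drawn in
`Literature/NumberTheory/Automorphic/QuaternionAlgebraExistence.lean`.)

## References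

* O. T. O'Meara, *Introduction to quadratic forms*, Grundlehren 117, Springer (1963), §63B
  (63:13, 63:13a) and §65A (local norms).
* J.-P. Serre, *Local Fields*, GTM 67 (1979), Ch. XIII §4, Prop. 9 and Cor. to Prop. 8
  (`(K* : N L*) = [L : K]` for abelian `L/K`); Ch. XIV §3 (the quadratic case and the Hilbert
  symbol).
-/

noncomputable section

namespace Literature.NumberTheory.QuadraticForms

open Polynomial IntermediateField

/-! ### The quadratic extension `F⟮√a⟯` and its norm form -/

section Quadratic

variable {F : Type*} [Field F] {Ω : Type*} [Field Ω] [Algebra F Ω]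

/-- A square root of `a` is integral over `F` (root of `X² - a`). [folklore] -/
theorem isIntegral_of_sq_eq {a : F} {α : Ω} (hα : α ^ 2 = algebraMap F Ω a) : IsIntegral F α :=
  ⟨X ^ 2 - C a, monic_X_pow_sub_C a two_ne_zero, by simp [hα]⟩

/-- `X² - a` is irreducible over `F` when `a` is not a square in `F` (a monic quadratic without
roots). [folklore] -/
theorem irreducible_X_sq_sub_C {a : F} (ha : ¬ IsSquare a) : Irreducible (X ^ 2 - C a : F[X]) := by
  have hmonic : (X ^ 2 - C a : F[X]).Monic := monic_X_pow_sub_C a two_ne_zero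
  rw [hmonic.irreducible_iff_roots_eq_zero_of_degree_le_three
    (by rw [natDegree_X_pow_sub_C]) (by rw [natDegree_X_pow_sub_C]; norm_num),
    Multiset.eq_zero_iff_forall_notMem]
  intro r hr
  rw [mem_roots hmonic.ne_zero, IsRoot, eval_sub, eval_pow, eval_X, eval_C, sub_eq_zero] at hr
  exact ha ⟨r, by rw [← hr, sq]⟩

/-- The minimal polynomial of a square root `α` of a non-square `a ∈ F` is `X² - a`. [folklore] -/
theorem minpoly_of_sq_eq {a : F} (ha : ¬ IsSquare a) {α : Ω} (hα : α ^ 2 = algebraMap F Ω a) :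
    minpoly F α = X ^ 2 - C a :=
  (minpoly.eq_of_irreducible_of_monic (irreducible_X_sq_sub_C ha) (by simp [hα])
    (monic_X_pow_sub_C a two_ne_zero)).symm

/-- `[F⟮α⟯ : F] = 2` for a square root `α` of a non-square `a ∈ F`. [folklore] -/
theorem finrank_adjoin_of_sq_eq {a : F} (ha : ¬ IsSquare a) {α : Ω}
    (hα : α ^ 2 = algebraMap F Ω a) : Module.finrank F F⟮α⟯ = 2 := by
  rw [adjoin.finrank (isIntegral_of_sq_eq hα), minpoly_of_sq_eq ha hα, natDegree_X_pow_sub_C]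

/-- The generator `α ∈ F⟮α⟯` squares to `a`. [folklore] -/
theorem gen_sq_of_sq_eq {a : F} {α : Ω} (hα : α ^ 2 = algebraMap F Ω a) :
    (AdjoinSimple.gen F α) ^ 2 = algebraMap F F⟮α⟯ a := by
  apply Subtype.ext
  change α ^ 2 = algebraMap F Ω a
  exact hα

/-- Every element of `F⟮α⟯` (`α² = a` a non-square) is `x + y α` with `x y ∈ F` (the power
basis `1, α`). [folklore] -/
theorem exists_eq_add_mul_gen_of_sq_eq {a : F} (ha : ¬ IsSquare a) {α : Ω}
    (hα : α ^ 2 = algebraMap F Ω a) (z : F⟮α⟯) :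
    ∃ x y : F, z = algebraMap F F⟮α⟯ x + algebraMap F F⟮α⟯ y * AdjoinSimple.gen F α := by
  classical
  set pb := adjoin.powerBasis (isIntegral_of_sq_eq hα) with hpb
  have hdim : pb.dim = 2 := by
    rw [hpb, adjoin.powerBasis_dim, minpoly_of_sq_eq ha hα, natDegree_X_pow_sub_C]
  set b : Module.Basis (Fin 2) F F⟮α⟯ := pb.basis.reindex (finCongr hdim) with hb
  have hb0 : b 0 = 1 := by
    rw [hb, Module.Basis.reindex_apply, pb.basis_eq_pow]
    simp
  have hb1 : b 1 = AdjoinSimple.gen F α := by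
    rw [hb, Module.Basis.reindex_apply, pb.basis_eq_pow]
    simp [hpb, adjoin.powerBasis_gen]
  have hsum := b.sum_repr z
  rw [Fin.sum_univ_two, hb0, hb1, Algebra.smul_def, Algebra.smul_def, mul_one] at hsum
  exact ⟨b.repr z 0, b.repr z 1, hsum.symm⟩

/-- **The norm form of `F⟮√a⟯/F`**: `N(x + y α) = x² - a y²` for `α² = a` a non-square
(determinant of the multiplication by `x + y α` in the basis `1, α`:
`[[x, a y], [y, x]]`). [folklore] -/
theorem norm_adjoin_of_sq_eq {a : F} (ha : ¬ IsSquare a) {α : Ω} (hα : α ^ 2 = algebraMap F Ω a)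
    (x y : F) :
    Algebra.norm F (algebraMap F F⟮α⟯ x + algebraMap F F⟮α⟯ y * AdjoinSimple.gen F α) =
      x ^ 2 - a * y ^ 2 := by
  classical
  set pb := adjoin.powerBasis (isIntegral_of_sq_eq hα) with hpb
  have hdim : pb.dim = 2 := by
    rw [hpb, adjoin.powerBasis_dim, minpoly_of_sq_eq ha hα, natDegree_X_pow_sub_C]
  -- the basis `1, α` indexed by `Fin 2`
  set b : Module.Basis (Fin 2) F F⟮α⟯ := pb.basis.reindex (finCongr hdim) with hb
  have hb0 : b 0 = 1 := by
    rw [hb, Module.Basis.reindex_apply, pb.basis_eq_pow]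
    simp
  have hb1 : b 1 = AdjoinSimple.gen F α := by
    rw [hb, Module.Basis.reindex_apply, pb.basis_eq_pow]
    simp [hpb, adjoin.powerBasis_gen]
  set g := AdjoinSimple.gen F α with hg
  set z := algebraMap F F⟮α⟯ x + algebraMap F F⟮α⟯ y * g with hz
  have hg2 : g * g = algebraMap F F⟮α⟯ a := by rw [← sq, hg, gen_sq_of_sq_eq hα]
  -- `z · 1` and `z · α` in the basis
  have hz0 : z * b 0 = x • b 0 + y • b 1 := by
    rw [hb0, hb1, mul_one, hz, Algebra.smul_def, Algebra.smul_def, mul_one]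
  have hz1 : z * b 1 = (a * y) • b 0 + x • b 1 := by
    rw [hb0, hb1, hz, Algebra.smul_def, Algebra.smul_def, mul_one, add_mul, mul_assoc, hg2,
      map_mul]
    ring
  rw [Algebra.norm_eq_matrix_det b, Matrix.det_fin_two, Algebra.leftMulMatrix_eq_repr_mul,
    Algebra.leftMulMatrix_eq_repr_mul, Algebra.leftMulMatrix_eq_repr_mul,
    Algebra.leftMulMatrix_eq_repr_mul, hz0, hz1]
  simp
  ring

/-- **The norm group of `F⟮√a⟯/F` is `quadraticNormSubgroup F a`**: the units of `F` of the
form `x² - a y²` are exactly the norms of units of `F⟮α⟯`, `α² = a` a non-square (O'Meara §65A: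
"local norm"). [folklore] -/
theorem range_norm_adjoin_of_sq_eq {a : F} (ha : ¬ IsSquare a) {α : Ω}
    (hα : α ^ 2 = algebraMap F Ω a) :
    (Units.map (Algebra.norm F : F⟮α⟯ →* F)).range = quadraticNormSubgroup F a := by
  haveI := adjoin.finiteDimensional (isIntegral_of_sq_eq hα)
  ext t
  constructor
  · rintro ⟨w, rfl⟩
    obtain ⟨x, y, hxy⟩ := exists_eq_add_mul_gen_of_sq_eq ha hα (w : F⟮α⟯)
    refine ⟨x, y, ?_⟩
    change x ^ 2 - a * y ^ 2 = Algebra.norm F (w : F⟮α⟯)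
    rw [hxy, norm_adjoin_of_sq_eq ha hα]
  · rintro ⟨x, y, hxy⟩
    set z := algebraMap F F⟮α⟯ x + algebraMap F F⟮α⟯ y * AdjoinSimple.gen F α with hz
    have hnz : Algebra.norm F z = t := by rw [hz, norm_adjoin_of_sq_eq ha hα, hxy]
    have hz0 : z ≠ 0 := by
      intro h
      rw [h, Algebra.norm_zero] at hnz
      exact t.ne_zero hnz.symm
    refine ⟨Units.mk0 z hz0, Units.ext ?_⟩
    change Algebra.norm F (Units.mk0 z hz0 : F⟮α⟯) = t
    rw [Units.val_mk0, hnz]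

end Quadratic

/-! ### `F(√a) ⊆ F̄` is abelian Galois of degree `2` -/

section Galois

variable {F : Type*} [Field F]

/-- Every `a ∈ F` has a square root in the algebraic closure `F̄`. [folklore] -/
theorem exists_sq_eq_algebraicClosure (a : F) :
    ∃ α : AlgebraicClosure F, α ^ 2 = algebraMap F _ a := by
  obtain ⟨α, hα⟩ := IsAlgClosed.exists_eq_mul_self (algebraMap F (AlgebraicClosure F) a)
  exact ⟨α, by rw [sq, ← hα]⟩

/-- For `2 ≠ 0` in `F`, `a` a non-square and `α ∈ F̄` a square root of `a`: the field
`F((X² - a).rootSet F̄)` generated by the roots `±α` of `X² - a` is `F⟮α⟯`. [folklore] -/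
theorem adjoin_rootSet_X_sq_sub_C_eq {a : F} (ha : ¬ IsSquare a) {α : AlgebraicClosure F}
    (hα : α ^ 2 = algebraMap F _ a) :
    adjoin F ((X ^ 2 - C a : F[X]).rootSet (AlgebraicClosure F)) = F⟮α⟯ := by
  have ha0 : a ≠ 0 := by rintro rfl; exact ha IsSquare.zero
  have hroots : (X ^ 2 - C a : F[X]).rootSet (AlgebraicClosure F) ⊆ {α, -α} := by
    intro r hr
    rw [mem_rootSet_of_ne (monic_X_pow_sub_C a two_ne_zero).ne_zero] at hr
    simp only [map_sub, map_pow, aeval_X, aeval_C, sub_eq_zero] at hr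
    have h : (r - α) * (r + α) = 0 := by linear_combination hr - hα
    rcases mul_eq_zero.1 h with h | h
    · exact Or.inl (sub_eq_zero.1 h)
    · exact Or.inr (eq_neg_of_add_eq_zero_left h)
  have hαmem : α ∈ (X ^ 2 - C a : F[X]).rootSet (AlgebraicClosure F) := by
    rw [mem_rootSet_of_ne (monic_X_pow_sub_C a two_ne_zero).ne_zero]
    simp [hα]
  apply le_antisymm
  · rw [adjoin_le_iff]
    intro r hr
    rcases hroots hr with rfl | rfl
    · exact mem_adjoin_simple_self F r
    · exact neg_mem (mem_adjoin_simple_self F _)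
  · exact adjoin.mono F _ _ (Set.singleton_subset_iff.2 hαmem)

/-- **`F(√a)/F` is abelian Galois** (`2 ≠ 0`, `a` a non-square): it is the splitting field of
the separable polynomial `X² - a`, of degree `2`, so its Galois group has order `2` and is
cyclic. [folklore] -/
theorem isAbelianGalois_adjoin_rootSet [NeZero (2 : F)] {a : F} (ha : ¬ IsSquare a) :
    haveI E := adjoin F ((X ^ 2 - C a : F[X]).rootSet (AlgebraicClosure F))
    FiniteDimensional F E ∧ IsAbelianGalois F E ∧ Module.finrank F E = 2 := by
  have ha0 : a ≠ 0 := by rintro rfl; exact ha IsSquare.zero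
  set p : F[X] := X ^ 2 - C a with hp
  set E := adjoin F (p.rootSet (AlgebraicClosure F)) with hE
  haveI hsplit : p.IsSplittingField F E :=
    adjoin_rootSet_isSplittingField (IsAlgClosed.splits _)
  haveI hfd : FiniteDimensional F E := Polynomial.IsSplittingField.finiteDimensional E p
  have hsep : p.Separable :=
    separable_X_pow_sub_C a (by exact_mod_cast (two_ne_zero : (2 : F) ≠ 0)) ha0
  haveI hgal : IsGalois F E := IsGalois.of_separable_splitting_field hsep
  obtain ⟨α, hα⟩ := exists_sq_eq_algebraicClosure a
  have hEα : E = F⟮α⟯ := by rw [hE, hp]; exact adjoin_rootSet_X_sq_sub_C_eq ha hα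
  have hrank : Module.finrank F E = 2 := by rw [hEα]; exact finrank_adjoin_of_sq_eq ha hα
  have hcard : Nat.card Gal(E/F) = 2 := by rw [IsGalois.card_aut_eq_finrank, hrank]
  haveI : Fact (Nat.Prime 2) := ⟨Nat.prime_two⟩
  haveI : IsCyclic Gal(E/F) := isCyclic_of_prime_card hcard
  exact ⟨hfd, IsAbelianGalois.of_isCyclic F E, hrank⟩

end Galois

/-! ### O'Meara 63:13a and 63:13 from the fundamental equality of local class field theory -/

/-- **O'Meara 63:13a at every place, from local class field theory**: over a non-archimedean
local field `F` with `2 ≠ 0`, for a non-square `a` the norm group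
`N_{F(√a)/F} = quadraticNormSubgroup F a` has index `2` in `Fˣ` — the case `E = F(√a)`
(`[E : F] = 2`) of the fundamental equality `[Fˣ : N_{E/F}(Eˣ)] = [E : F]` for abelian `E/F`
(Serre, *Local Fields*, XIII §4 Prop. 9; the named fact `index_normSubgroup_eq_finrank F`).
[cite: Omeara1963, §63B Cor. 63:13a] -/
theorem index_quadraticNormSubgroup_eq_two_of_index_normSubgroup_eq_finrank (F : Type*)
    [Field F] [ValuativeRel F] [TopologicalSpace F] [IsNonarchimedeanLocalField F]
    [NeZero (2 : F)] (h : GaloisRepresentations.index_normSubgroup_eq_finrank F) {a : F} (ha : ¬ IsSquare a) :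
    (quadraticNormSubgroup F a).index = 2 := by
  obtain ⟨hfd, hab, hrank⟩ := isAbelianGalois_adjoin_rootSet (F := F) ha
  obtain ⟨α, hα⟩ := exists_sq_eq_algebraicClosure a
  have hEα := adjoin_rootSet_X_sq_sub_C_eq ha hα
  have hidx := h (adjoin F ((X ^ 2 - C a : F[X]).rootSet (AlgebraicClosure F))) hfd hab
  rw [hrank] at hidx
  -- transport along `E = F⟮α⟯` and identify the norm group
  have key : ∀ E : IntermediateField F (AlgebraicClosure F), E = F⟮α⟯ →
      (Units.map (Algebra.norm F : E →* F)).range.index = 2 →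
      (quadraticNormSubgroup F a).index = 2 := by
    rintro E rfl hE
    rwa [range_norm_adjoin_of_sq_eq ha hα] at hE
  exact key _ hEα hidx

open NumberField IsDedekindDomain in
/-- **O'Meara 63:13 from local class field theory.** For a number field `K`, if the fundamental
equality `[K_vˣ : N_{E/K_v}(Eˣ)] = [E : K_v]` (abelian `E/K_v`; Serre XIII §4 Prop. 9, the named
fact `index_normSubgroup_eq_finrank (v.adicCompletion K)`) holds at every finite place `v`, then
so does the named fact `adicCompletion_exists_hilbertSymbol_eq_neg_one K` (O'Meara 63:13: for a
non-square `β ∈ K_v` some `α ∈ K_vˣ` has `(α, β)_v = -1`): the norm group of `K_v(√β)` has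
index `2`, hence misses a unit `α`, and `(α, β)_v = -1` by
`hilbertSymbol_eq_neg_one_iff_not_mem_quadraticNormSubgroup`. (`K_v` is a non-archimedean local
field: `AdicCompletionLocalField.lean`.) [cite: Omeara1963, §63B Prop. 63:13] -/
theorem adicCompletion_exists_hilbertSymbol_eq_neg_one_of_index_normSubgroup_eq_finrank
    (K : Type) [Field K] [NumberField K]
    (h : ∀ v : HeightOneSpectrum (𝓞 K), GaloisRepresentations.index_normSubgroup_eq_finrank (v.adicCompletion K)) :
    adicCompletion_exists_hilbertSymbol_eq_neg_one K := by
  intro v β hβ0 hβ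
  haveI : CharZero (v.adicCompletion K) :=
    charZero_of_injective_algebraMap (algebraMap K _).injective
  have hidx := index_quadraticNormSubgroup_eq_two_of_index_normSubgroup_eq_finrank
    (v.adicCompletion K) (h v) hβ
  have hne : quadraticNormSubgroup (v.adicCompletion K) β ≠ ⊤ := by
    intro htop
    rw [htop, Subgroup.index_top] at hidx
    exact absurd hidx (by norm_num)
  obtain ⟨t, ht⟩ :
      ∃ t : (v.adicCompletion K)ˣ, t ∉ quadraticNormSubgroup (v.adicCompletion K) β := by
    by_contra hall
    push Not at hall
    exact hne ((Subgroup.eq_top_iff' _).2 hall)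
  exact ⟨t, t.ne_zero,
    (hilbertSymbol_eq_neg_one_iff_not_mem_quadraticNormSubgroup hβ0 t).2 ht⟩

end Literature.NumberTheory.QuadraticForms
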